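import Mathlib
import HarnessLib

/-!
# Onset scales: the supremum of the onset set is attained (abstract real analysis)

Layer-2 lemma named in the thesis of route `OnsetSkewLaw` («the continuity/attainment lemma for amp») and used by the
glue `SkewFloorsGlue` (stmt-QuantumFields-23139): for a family of «reflection-positivity squares»
`RP q s y` (orientation `q : Fin 4 × Fin 4`, resolution `s > 0`, offset `y` in the box `[0,s]⁴ ⊆ ℝ⁴`) that is jointly
continuous in `(s, y)` on `s > 0`, the ONSET SET of level `ε`,
`onset = {s > 0 | ∃ q, ∃ y ∈ [0,s]⁴, ε ≤ RP q s y}`,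
if non-empty and bounded, has an ATTAINED supremum `ŝ = sSup onset ∈ onset`, and at `ŝ` every square is `≤ ε`
(so the amplitude `sup_{q,y} RP q ŝ y` equals `ε` exactly), while above `ŝ` every square is `< ε`.
Pure topology (compactness of `[0,s]⁴ × orientations`, sequences); Mathlib only; THEOREMS ONLY.

Free-hands width seat `ym-line-sfw-p2-w4` (cell ym-idea-1).  Nothing about the Yang–Mills mass gap is proved here.
-/

set_option autoImplicit false

namespace Summit.QuantumFields.YangMills.Theorems.OnsetSkewLawGlue

open Filter Topology Set

/-- The offset box `[0, s]⁴ ⊆ ℝ⁴` is compact. [folklore] -/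
theorem isCompact_offsetBox (s : ℝ) :
    IsCompact {y : EuclideanSpace ℝ (Fin 4) | ∀ i, 0 ≤ y i ∧ y i ≤ s} := by
  have hclosed : IsClosed {y : EuclideanSpace ℝ (Fin 4) | ∀ i, 0 ≤ y i ∧ y i ≤ s} := by
    have : {y : EuclideanSpace ℝ (Fin 4) | ∀ i, 0 ≤ y i ∧ y i ≤ s} =
        ⋂ i, {y : EuclideanSpace ℝ (Fin 4) | 0 ≤ y i ∧ y i ≤ s} := by
      ext y; simp
    rw [this]
    refine isClosed_iInter fun i => ?_
    have hc : Continuous fun y : EuclideanSpace ℝ (Fin 4) => y i := (PiLp.continuous_apply 2 _ i)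
    exact (isClosed_le continuous_const hc).inter (isClosed_le hc continuous_const)
  refine Metric.isCompact_of_isClosed_isBounded hclosed ?_
  refine (Metric.isBounded_closedBall (x := (0 : EuclideanSpace ℝ (Fin 4))) (r := 2 * |s|)).subset ?_
  intro y hy
  rw [Metric.mem_closedBall, dist_zero_right, EuclideanSpace.norm_eq]
  have hcoord : ∀ i, y i ^ 2 ≤ s ^ 2 := by
    intro i
    have h0 := (hy i).1
    have h1 := (hy i).2
    nlinarith
  have hsum : ∑ i : Fin 4, y i ^ 2 ≤ 4 * s ^ 2 := by
    calc ∑ i : Fin 4, y i ^ 2 ≤ ∑ _i : Fin 4, s ^ 2 := Finset.sum_le_sum fun i _ => hcoord i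
      _ = 4 * s ^ 2 := by simp
  calc Real.sqrt (∑ i : Fin 4, ‖y i‖ ^ 2) = Real.sqrt (∑ i : Fin 4, y i ^ 2) := by simp [Real.norm_eq_abs, sq_abs]
    _ ≤ Real.sqrt (4 * s ^ 2) := Real.sqrt_le_sqrt hsum
    _ = 2 * |s| := by
        rw [show (4 : ℝ) * s ^ 2 = (2 * |s|) ^ 2 by rw [mul_pow, sq_abs]; norm_num]
        exact Real.sqrt_sq (by positivity)

/-- On the compact box, a square continuous in the offset is bounded above (so `⨆` over the box is a genuine sup).
[folklore] -/
theorem bddAbove_range_box (RP : Fin 4 × Fin 4 → ℝ → EuclideanSpace ℝ (Fin 4) → ℝ) (s : ℝ)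
    (hcont : ∀ q, ∀ y : EuclideanSpace ℝ (Fin 4), ContinuousAt (fun sy : ℝ × EuclideanSpace ℝ (Fin 4) => RP q sy.1 sy.2) (s, y)) :
    BddAbove (Set.range fun p : {p : (Fin 4 × Fin 4) × EuclideanSpace ℝ (Fin 4) // ∀ i, 0 ≤ p.2 i ∧ p.2 i ≤ s} =>
      RP p.1.1 s p.1.2) := by
  -- for each `q`, `y ↦ RP q s y` is continuous, hence bounded on the compact box
  have hq : ∀ q : Fin 4 × Fin 4, ∃ B : ℝ, ∀ y : EuclideanSpace ℝ (Fin 4), (∀ i, 0 ≤ y i ∧ y i ≤ s) → RP q s y ≤ B := by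
    intro q
    have hc : ContinuousOn (fun y : EuclideanSpace ℝ (Fin 4) => RP q s y)
        {y : EuclideanSpace ℝ (Fin 4) | ∀ i, 0 ≤ y i ∧ y i ≤ s} := by
      intro y _
      have h := (hcont q y).comp_of_eq ((continuousAt_const.prodMk continuousAt_id) : ContinuousAt
        (fun y' : EuclideanSpace ℝ (Fin 4) => ((s, y') : ℝ × EuclideanSpace ℝ (Fin 4))) y) rfl
      exact h.continuousWithinAt
    obtain ⟨B, hB⟩ := (isCompact_offsetBox s).bddAbove_image hc
    exact ⟨B, fun y hy => hB ⟨y, hy, rfl⟩⟩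
  choose B hB using hq
  refine ⟨Finset.univ.sup' Finset.univ_nonempty B, ?_⟩
  rintro _ ⟨⟨⟨q, y⟩, hy⟩, rfl⟩
  exact (hB q y hy).trans (Finset.le_sup' B (Finset.mem_univ q))

/-- **Attainment of the onset supremum.**  For squares jointly continuous in `(s, y)` on `s > 0`, if the onset set of
level `ε` is non-empty and bounded above by `s₀`, then `ŝ := sSup onset` is positive, lies in the onset set (some square at
resolution `ŝ` is `≥ ε`), every square at resolution `ŝ` is `≤ ε`, every square at a resolution `> ŝ` is `< ε`, and
`onset ≤ ŝ ≤ s₀`. [folklore] -/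
theorem onset_sSup_spec (RP : Fin 4 × Fin 4 → ℝ → EuclideanSpace ℝ (Fin 4) → ℝ)
    (hcont : ∀ q, ∀ s : ℝ, 0 < s → ∀ y : EuclideanSpace ℝ (Fin 4),
      ContinuousAt (fun sy : ℝ × EuclideanSpace ℝ (Fin 4) => RP q sy.1 sy.2) (s, y))
    (ε s₀ : ℝ)
    (hne : ∃ s, 0 < s ∧ ∃ (q : Fin 4 × Fin 4) (y : EuclideanSpace ℝ (Fin 4)), (∀ i, 0 ≤ y i ∧ y i ≤ s) ∧ ε ≤ RP q s y)
    (hbdd : ∀ s, (0 < s ∧ ∃ (q : Fin 4 × Fin 4) (y : EuclideanSpace ℝ (Fin 4)), (∀ i, 0 ≤ y i ∧ y i ≤ s) ∧ ε ≤ RP q s y) →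
      s ≤ s₀) :
    0 < sSup {s | 0 < s ∧ ∃ (q : Fin 4 × Fin 4) (y : EuclideanSpace ℝ (Fin 4)), (∀ i, 0 ≤ y i ∧ y i ≤ s) ∧ ε ≤ RP q s y} ∧
    (∃ (q : Fin 4 × Fin 4) (y : EuclideanSpace ℝ (Fin 4)),
      (∀ i, 0 ≤ y i ∧ y i ≤ sSup {s | 0 < s ∧ ∃ (q : Fin 4 × Fin 4) (y : EuclideanSpace ℝ (Fin 4)),
        (∀ i, 0 ≤ y i ∧ y i ≤ s) ∧ ε ≤ RP q s y}) ∧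
      ε ≤ RP q (sSup {s | 0 < s ∧ ∃ (q : Fin 4 × Fin 4) (y : EuclideanSpace ℝ (Fin 4)),
        (∀ i, 0 ≤ y i ∧ y i ≤ s) ∧ ε ≤ RP q s y}) y) ∧
    (∀ (q : Fin 4 × Fin 4) (y : EuclideanSpace ℝ (Fin 4)),
      (∀ i, 0 ≤ y i ∧ y i ≤ sSup {s | 0 < s ∧ ∃ (q : Fin 4 × Fin 4) (y : EuclideanSpace ℝ (Fin 4)),
        (∀ i, 0 ≤ y i ∧ y i ≤ s) ∧ ε ≤ RP q s y}) →
      RP q (sSup {s | 0 < s ∧ ∃ (q : Fin 4 × Fin 4) (y : EuclideanSpace ℝ (Fin 4)),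
        (∀ i, 0 ≤ y i ∧ y i ≤ s) ∧ ε ≤ RP q s y}) y ≤ ε) ∧
    (∀ s, sSup {s | 0 < s ∧ ∃ (q : Fin 4 × Fin 4) (y : EuclideanSpace ℝ (Fin 4)),
        (∀ i, 0 ≤ y i ∧ y i ≤ s) ∧ ε ≤ RP q s y} < s →
      ∀ (q : Fin 4 × Fin 4) (y : EuclideanSpace ℝ (Fin 4)), (∀ i, 0 ≤ y i ∧ y i ≤ s) → RP q s y < ε) ∧
    (∀ s, (0 < s ∧ ∃ (q : Fin 4 × Fin 4) (y : EuclideanSpace ℝ (Fin 4)), (∀ i, 0 ≤ y i ∧ y i ≤ s) ∧ ε ≤ RP q s y) →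
      s ≤ sSup {s | 0 < s ∧ ∃ (q : Fin 4 × Fin 4) (y : EuclideanSpace ℝ (Fin 4)),
        (∀ i, 0 ≤ y i ∧ y i ≤ s) ∧ ε ≤ RP q s y}) ∧
    sSup {s | 0 < s ∧ ∃ (q : Fin 4 × Fin 4) (y : EuclideanSpace ℝ (Fin 4)), (∀ i, 0 ≤ y i ∧ y i ≤ s) ∧ ε ≤ RP q s y} ≤ s₀ := by
  set O : Set ℝ := {s | 0 < s ∧ ∃ (q : Fin 4 × Fin 4) (y : EuclideanSpace ℝ (Fin 4)),
    (∀ i, 0 ≤ y i ∧ y i ≤ s) ∧ ε ≤ RP q s y} with hO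
  have hOne : O.Nonempty := hne
  have hObdd : BddAbove O := ⟨s₀, fun s hs => hbdd s hs⟩
  have hle : ∀ s ∈ O, s ≤ sSup O := fun s hs => le_csSup hObdd hs
  have hsup_le : sSup O ≤ s₀ := csSup_le hOne fun s hs => hbdd s hs
  obtain ⟨s₁, hs₁⟩ := hne
  have hpos : 0 < sSup O := lt_of_lt_of_le hs₁.1 (hle s₁ hs₁)
  -- above the sup nothing is in the onset set
  have habove : ∀ s, sSup O < s → ∀ (q : Fin 4 × Fin 4) (y : EuclideanSpace ℝ (Fin 4)),
      (∀ i, 0 ≤ y i ∧ y i ≤ s) → RP q s y < ε := by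
    intro s hs q y hy
    by_contra hge
    rw [not_lt] at hge
    have hmem : s ∈ O := ⟨hpos.trans hs, q, y, hy, hge⟩
    exact absurd (hle s hmem) (not_le.mpr hs)
  -- attainment: a sequence in `O` increasing to the sup, witnesses, compactness
  obtain ⟨u, -, hu, huO⟩ := exists_seq_tendsto_sSup hOne hObdd
  choose q y hy hε using fun n => (huO n).2
  have hupos : ∀ n, 0 < u n := fun n => (huO n).1
  set K : Set ((Fin 4 × Fin 4) × EuclideanSpace ℝ (Fin 4)) :=
    Set.univ ×ˢ {y : EuclideanSpace ℝ (Fin 4) | ∀ i, 0 ≤ y i ∧ y i ≤ s₀} with hK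
  have hKc : IsCompact K := isCompact_univ.prod (isCompact_offsetBox s₀)
  have hmemK : ∀ n, (q n, y n) ∈ K := by
    intro n
    refine ⟨Set.mem_univ _, fun i => ⟨(hy n i).1, (hy n i).2.trans (hbdd _ (huO n))⟩⟩
  obtain ⟨⟨q₀, y₀⟩, -, φ, hφ, hlim⟩ := hKc.tendsto_subseq hmemK
  have hq_lim : Tendsto (fun n => q (φ n)) atTop (𝓝 q₀) := (continuous_fst.tendsto _).comp hlim
  have hy_lim : Tendsto (fun n => y (φ n)) atTop (𝓝 y₀) := (continuous_snd.tendsto _).comp hlim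
  have hq_ev : ∀ᶠ n in atTop, q (φ n) = q₀ := by
    have : {q₀} ∈ 𝓝 q₀ := (isOpen_discrete _).mem_nhds (Set.mem_singleton _)
    exact hq_lim.eventually (eventually_of_mem this fun x hx => hx)
  have hu_lim : Tendsto (fun n => u (φ n)) atTop (𝓝 (sSup O)) := hu.comp hφ.tendsto_atTop
  -- `y₀` lies in the box of side `sSup O`
  have hy₀ : ∀ i, 0 ≤ y₀ i ∧ y₀ i ≤ sSup O := by
    intro i
    have hci : Tendsto (fun n => y (φ n) i) atTop (𝓝 (y₀ i)) :=
      ((PiLp.continuous_apply 2 _ i).tendsto _).comp hy_lim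
    refine ⟨ge_of_tendsto' hci fun n => (hy (φ n) i).1, ?_⟩
    exact le_of_tendsto_of_tendsto' hci hu_lim fun n => (hy (φ n) i).2
  -- the square at the limit is `≥ ε` by continuity
  have hRP_lim : Tendsto (fun n => RP q₀ (u (φ n)) (y (φ n))) atTop (𝓝 (RP q₀ (sSup O) y₀)) := by
    have hc := hcont q₀ (sSup O) hpos y₀
    have hprod : Tendsto (fun n => (u (φ n), y (φ n))) atTop (𝓝 (sSup O, y₀)) := hu_lim.prodMk_nhds hy_lim
    exact hc.tendsto.comp hprod
  have hattain : ε ≤ RP q₀ (sSup O) y₀ := by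
    refine ge_of_tendsto hRP_lim ?_
    filter_upwards [hq_ev] with n hn
    rw [← hn]
    exact hε (φ n)
  -- every square at the sup is `≤ ε` (approach from above)
  have hat_sup : ∀ (q' : Fin 4 × Fin 4) (y' : EuclideanSpace ℝ (Fin 4)),
      (∀ i, 0 ≤ y' i ∧ y' i ≤ sSup O) → RP q' (sSup O) y' ≤ ε := by
    intro q' y' hy'
    have hc := hcont q' (sSup O) hpos y'
    -- along `s ↓ sSup O` the squares are `< ε`
    have hseq : Tendsto (fun n : ℕ => sSup O + 1 / ((n : ℝ) + 1)) atTop (𝓝 (sSup O)) := by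
      have h : Tendsto (fun n : ℕ => 1 / ((n : ℝ) + 1)) atTop (𝓝 0) := tendsto_one_div_add_atTop_nhds_zero_nat
      simpa using h.const_add (sSup O)
    have hprod : Tendsto (fun n : ℕ => (sSup O + 1 / ((n : ℝ) + 1), y')) atTop (𝓝 (sSup O, y')) :=
      hseq.prodMk_nhds tendsto_const_nhds
    have hRP := hc.tendsto.comp hprod
    refine le_of_tendsto hRP (Eventually.of_forall fun n => le_of_lt ?_)
    have hgt : sSup O < sSup O + 1 / ((n : ℝ) + 1) := by
      have : (0 : ℝ) < 1 / ((n : ℝ) + 1) := by positivity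
      linarith
    exact habove _ hgt q' y' fun i => ⟨(hy' i).1, (hy' i).2.trans hgt.le⟩
  exact ⟨hpos, ⟨q₀, y₀, hy₀, hattain⟩, hat_sup, habove, hle, hsup_le⟩

end Summit.QuantumFields.YangMills.Theorems.OnsetSkewLawGlue
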